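import Literature.Topology.FourManifolds.LoopSurgeryTrisectionEulerProofs
import Summits.SmoothPoincare4.SmoothPoincare4.Theorems.WeakReductionDescentWeakReductionReducesStubLoopNoDescentFromFiveAux3

/-!
# `stub_loopNoDescentFromFive` (L₅) ⇐ Meier–Schirmer–Zupan ∧ the typed residue
(line `loop_dichotomy`, crux `WeakReductionDescent.WeakReductionReduces` = stmt-SmoothPoincare4-17908)

Final form of the reduction of the registered stub L₅ (a smooth homotopy 4-sphere of minimal
GK-trisection genus `g ≥ 5` is not a circle surgery on a smooth `X` trisected with genus `< g`):

  `helper_loopNoDescentFromFive_of_msz : F1 → H_res → L₅` (L₅ VERBATIM as conclusion),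

where F1 = `Literature.Topology.FourManifolds.msz_loopSurgery_homotopySphere_gk` is the ONLY
remaining cited input (Meier–Schirmer–Zupan 2016 Thm. 1.2, arXiv numbering, for loop presentations
of homotopy spheres: a closed connected oriented `X` with a `(g; k)`-GK-trisection in the MSZ
range whose surgery on a smoothly embedded loop is a homotopy 4-sphere `M` has `M ≅ S⁴`), and
H_res is the typed RESIDUE (a hypothesis; open, SPC4-implied): for `g ≥ 5`, no orientable loop
partner `X` with a `(g'; k')`-GK-trisection of genus `4 ≤ g' < g` outside the MSZ range
(`k'ᵢ + 2 ≤ g'` for all `i`) and with `Σ k'ᵢ = g' + 2` presents a genus-`g`-minimal smooth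
homotopy 4-sphere by a loop surgery.  The other two inputs of the earlier reductions
(`…StubLoopNoDescentFromFiveAux1–3.lean`) are now THEOREMS of the tree:
`isOrientable_of_isCircleSurgery_four_holds` (`LoopSurgeryHomotopySphereProofs.lean`) and
`gkTrisection_sum_eq_add_two_of_loopSurgery_homotopySphere_holds`
(`LoopSurgeryTrisectionEulerProofs.lean`: Gay–Kirby's Remark 2 in general + the Euler
characteristic of a circle surgery, `CircleSurgeryEulerCharacteristic.lean`).  No `sorry`.
-/

-- the registered namespace `Summit.SmoothPoincare4.SmoothPoincare4.…` repeats a component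
set_option linter.dupNamespace false

open scoped Manifold ContDiff ContinuousMap Topology
open Literature.Topology.FourManifolds

namespace Summit.SmoothPoincare4.SmoothPoincare4.Theorems.WeakReductionReduces.LoopDichotomy

/-- **L₅ from MSZ16 and the typed residue H_res (all rungs `g ≥ 5`).**  Hypotheses: (F1)
`msz_loopSurgery_homotopySphere_gk` (cited); (H_res) the residue (NOT a literature fact).
Conclusion: the registered stub `stub_loopNoDescentFromFive` verbatim; the `χ`-bookkeeping
`Σ k' = g' + 2` is the PROVED `gkTrisection_sum_eq_add_two_of_loopSurgery_homotopySphere_holds`,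
fed to `helper_loopNoDescentFromFive_of_residue`.  Conditional on F1 and H_res (D-0014).
[cite: MeierSchirmerZupan2016, Thm. 1.2 (arXiv numbering)] [cite: GayKirby2016, Remark 2] -/
theorem helper_loopNoDescentFromFive_of_msz : Literature.Topology.FourManifolds.msz_loopSurgery_homotopySphere_gk → (∀ (M : Type) [TopologicalSpace M] [T2Space M] [SecondCountableTopology M] [ChartedSpace (EuclideanSpace ℝ (Fin 4)) M] [IsManifold (𝓡 4) ∞ M], (M ≃ₕ (Metric.sphere (0 : EuclideanSpace ℝ (Fin 5)) 1)) → ∀ (g : ℕ) (k : Fin 3 → ℕ) (T : Fin 3 → Set M), Literature.Topology.FourManifolds.IsGKTrisection M g k T → 5 ≤ g → (∀ (g'' : ℕ) (k'' : Fin 3 → ℕ) (T'' : Fin 3 → Set M), Literature.Topology.FourManifolds.IsGKTrisection M g'' k'' T'' → g ≤ g'') → ∀ (X : Type) [TopologicalSpace X] [T2Space X] [SecondCountableTopology X] [ChartedSpace (EuclideanSpace ℝ (Fin 4)) X] [IsManifold (𝓡 4) ∞ X], Literature.Topology.FourManifolds.IsOrientable (𝓡 4) X → ∀ (g' : ℕ)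 (k' : Fin 3 → ℕ) (T' : Fin 3 → Set X), 4 ≤ g' → g' < g → Literature.Topology.FourManifolds.IsGKTrisection X g' k' T' → k' 0 + k' 1 + k' 2 = g' + 2 → (∀ i, k' i + 2 ≤ g') → ∀ (ℓ : (Metric.sphere (0 : EuclideanSpace ℝ (Fin 2)) 1) → X), Manifold.IsSmoothEmbedding (𝓡 1) (𝓡 4) ∞ ℓ → ¬ Literature.Topology.FourManifolds.IsCircleSurgery (𝓡 4) (𝓡 4) X M ℓ) → ∀ (M : Type) [TopologicalSpace M] [T2Space M] [SecondCountableTopology M] [ChartedSpace (EuclideanSpace ℝ (Fin 4)) M] [IsManifold (𝓡 4) ∞ M], (M ≃ₕ (Metric.sphere (0 : EuclideanSpace ℝ (Fin 5)) 1)) → ∀ (g : ℕ) (k : Fin 3 → ℕ) (T : Fin 3 → Set M), Literature.Topology.FourManifolds.IsGKTrisection M g k T → 5 ≤ g → (∀ (g'' : ℕ) (k'' : Fin 3 → ℕ) (T'' : Fin 3 → Set M), Literature.Topology.FourManifolds.IsGKTrisection M g'' k'' T'' → g ≤ g'') → ∀ (X : Type) [TopologicalSpace X] [T2Space X] [SecondCountableTopology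 X] [ChartedSpace (EuclideanSpace ℝ (Fin 4)) X] [IsManifold (𝓡 4) ∞ X] (g' : ℕ) (k' : Fin 3 → ℕ) (T' : Fin 3 → Set X), g' < g → Literature.Topology.FourManifolds.IsGKTrisection X g' k' T' → ∀ (ℓ : (Metric.sphere (0 : EuclideanSpace ℝ (Fin 2)) 1) → X), Manifold.IsSmoothEmbedding (𝓡 1) (𝓡 4) ∞ ℓ → ¬ Literature.Topology.FourManifolds.IsCircleSurgery (𝓡 4) (𝓡 4) X M ℓ :=
  fun hF1 => helper_loopNoDescentFromFive_of_residue hF1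
    gkTrisection_sum_eq_add_two_of_loopSurgery_homotopySphere_holds

end Summit.SmoothPoincare4.SmoothPoincare4.Theorems.WeakReductionReduces.LoopDichotomy
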